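import Summits.CriticalPhenomena.PercolationContinuityZ3.Theorems.Transplant.FKConnectivityAllQAntipodalRootForm

/-!
# Connectivity correlation inequalities for `φ_{w,q}`, every `q > 0` — ROOT-FORM CALCULUS, file 61b: a parallel edge over a parallel
# edge, and the closure of the AND facts under both attachments

Support file (`--supports stmt-CriticalPhenomena-4575`), FK sub-lane `prim-bschramm-fk-2` (gen 28); builds on p205010 (kernel theorem,
internal audit signed; external expert review pending).  Standard axioms, no sorries.  Memo FROM-fk-2-g28-ROOT-FORM.md §2–§4, FK-Q2 §37.

Continues file 61a (`…AntipodalRootForm`): (PQ) `Mt_par_par_nonneg` — `M̃_{g∥(g'∥𝓔)} ≥ 0` from `M̃_{g'∥𝓔} ≥ 0` on the diagonal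
sections (two parallel edges in the same replica act as one, one level lower) and the contracted AND of `𝓔` on the mixed sections (two
parallel edges in opposite replicas contract the root); and the six closure lemmas of the AND facts (deleted / contracted / free-nested)
under a series and under a parallel edge.  With 61a this is the complete induction step of the word theorem (file 61c). [folklore]
-/

noncomputable section

namespace Summit.CriticalPhenomena.PercolationContinuityZ3.Theorems

namespace FK

namespace RootForm

open Finset

namespace PDat

variable (d : PDat) (J : ℤ)

/-- Two parallel edges in opposite replicas contract the root one level down: `[Λ+K¹≤J]` part. [folklore] -/
theorem a1_par_par_mixed (b : Bool) : ((d.par b).par (!b)).a1 J = d.acon (J - 1) := by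
  obtain ⟨l, k1, k2⟩ := d; cases b <;> cases k1 <;> cases k2 <;> simp [par, a1, acon]
/-- Mirror of `a1_par_par_mixed`. [folklore] -/
theorem a2_par_par_mixed (b : Bool) : ((d.par b).par (!b)).a2 J = d.acon (J - 1) := by
  obtain ⟨l, k1, k2⟩ := d; cases b <;> cases k1 <;> cases k2 <;> simp [par, a2, acon]
/-- Two parallel edges in opposite replicas: the root-exchange term becomes the exact contracted level. [folklore] -/
theorem r1_par_par_mixed (b : Bool) : ((d.par b).par (!b)).r1 J = ind (d.lam + bit d.k1 + bit d.k2 = J) := by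
  obtain ⟨l, k1, k2⟩ := d; cases b <;> cases k1 <;> cases k2 <;> simp [par, r1] <;> exact ind_congr (by omega)
/-- Mirror of `r1_par_par_mixed`. [folklore] -/
theorem r2_par_par_mixed (b : Bool) : ((d.par b).par (!b)).r2 J = ind (d.lam + bit d.k1 + bit d.k2 = J) := by
  obtain ⟨l, k1, k2⟩ := d; cases b <;> cases k1 <;> cases k2 <;> simp [par, r2] <;> exact ind_congr (by omega)
/-- Two parallel edges in the same replica act as one, one level lower: `[Λ+K¹≤J]` part. [folklore] -/
theorem a1_par_par_same (b : Bool) : ((d.par b).par b).a1 J = (d.par b).a1 (J - 1) := by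
  obtain ⟨l, k1, k2⟩ := d; cases b <;> cases k1 <;> cases k2 <;> simp [par, a1]
/-- See `a1_par_par_same`. [folklore] -/
theorem a2_par_par_same (b : Bool) : ((d.par b).par b).a2 J = (d.par b).a2 (J - 1) := by
  obtain ⟨l, k1, k2⟩ := d; cases b <;> cases k1 <;> cases k2 <;> simp [par, a2]
/-- See `a1_par_par_same`. [folklore] -/
theorem r1_par_par_same (b : Bool) : ((d.par b).par b).r1 J = (d.par b).r1 (J - 1) := by
  obtain ⟨l, k1, k2⟩ := d; cases b <;> cases k1 <;> cases k2 <;> simp [par, r1] <;> exact ind_congr (by omega)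
/-- See `a1_par_par_same`. [folklore] -/
theorem r2_par_par_same (b : Bool) : ((d.par b).par b).r2 J = (d.par b).r2 (J - 1) := by
  obtain ⟨l, k1, k2⟩ := d; cases b <;> cases k1 <;> cases k2 <;> simp [par, r2] <;> exact ind_congr (by omega)
/-- A parallel edge in replica 1: deleted bracket becomes `[Λ+K¹≤J]`. [folklore] -/
theorem adel_par_true : (d.par true).adel J = d.a1 J := by
  obtain ⟨l, k1, k2⟩ := d; cases k1 <;> cases k2 <;> simp [par, adel, a1]
/-- A parallel edge in replica 2: deleted bracket becomes `[Λ+K²≤J]`. [folklore] -/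
theorem adel_par_false : (d.par false).adel J = d.a2 J := by
  obtain ⟨l, k1, k2⟩ := d; cases k1 <;> cases k2 <;> simp [par, adel, a2]
/-- A parallel edge shifts the contracted bracket by one level. [folklore] -/
theorem acon_par (b : Bool) : (d.par b).acon J = d.acon (J - 1) := by
  obtain ⟨l, k1, k2⟩ := d; cases b <;> cases k1 <;> cases k2 <;> simp [par, acon]

end PDat

namespace EDat

variable (e : EDat) (J : ℤ)

/-- `Σ_r [Λ_r + K¹_r + K²_r = J]`, the exact contracted level of the single patterns (nonnegative). [folklore] -/
def rconE (e : EDat) (J : ℤ) : ℝ := ind (e.dy.lam + bit e.dy.k1 + bit e.dy.k2 = J) + ind (e.dz.lam + bit e.dz.k1 + bit e.dz.k2 = J)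
/-- `0 ≤ rconE`. [folklore] -/
theorem rconE_nonneg : 0 ≤ e.rconE J := add_nonneg (ind_nonneg _) (ind_nonneg _)
/-- (PQ), mixed sections: contracted AND one level down plus the exact contracted level. [folklore] -/
theorem slot1_par_par_mixed (b : Bool) : ((e.par b).par (!b)).slot1 J = e.andCon (J - 1) + e.rconE J := by
  simp [par, slot1, andCon, rconE, PDat.a1_par_par_mixed, PDat.r1_par_par_mixed]; ring
/-- See `slot1_par_par_mixed`. [folklore] -/
theorem slot0_par_par_mixed (b : Bool) : ((e.par b).par (!b)).slot0 J = e.andCon (J - 1) - e.rconE J := by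
  simp [par, slot0, andCon, rconE, PDat.a2_par_par_mixed, PDat.r2_par_par_mixed]; ring
/-- (PQ), equal sections: two parallel edges in one replica = one parallel edge, one level lower. [folklore] -/
theorem slot1_par_par_same (b : Bool) : ((e.par b).par b).slot1 J = (e.par b).slot1 (J - 1) := by
  simp [par, slot1, PDat.a1_par_par_same, PDat.r1_par_par_same]
/-- See `slot1_par_par_same`. [folklore] -/
theorem slot0_par_par_same (b : Bool) : ((e.par b).par b).slot0 J = (e.par b).slot0 (J - 1) := by
  simp [par, slot0, PDat.a2_par_par_same, PDat.r2_par_par_same]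
/-- Deleted AND after a parallel edge in replica 1 = AND with the root in replica 1. [folklore] -/
theorem andDel_par_true : (e.par true).andDel J = e.andE1 J := by simp [par, andDel, andE1, PDat.adel_par_true]
/-- Deleted AND after a parallel edge in replica 2 = AND with the root in replica 2. [folklore] -/
theorem andDel_par_false : (e.par false).andDel J = e.andE2 J := by simp [par, andDel, andE2, PDat.adel_par_false]
/-- Contracted AND after a parallel edge = contracted AND one level lower. [folklore] -/
theorem andCon_par (b : Bool) : (e.par b).andCon J = e.andCon (J - 1) := by simp [par, andCon, PDat.acon_par]
/-- `andE1` after a series edge in replica 1. [folklore] -/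
theorem andE1_ser_true : (e.ser true).andE1 J = e.andE1 J := by simp [ser, andE1, PDat.a1_ser_true]
/-- `andE1` after a series edge in replica 2. [folklore] -/
theorem andE1_ser_false : (e.ser false).andE1 J = e.andDel J := by simp [ser, andE1, andDel, PDat.a1_ser_false]
/-- `andE2` after a series edge in replica 1. [folklore] -/
theorem andE2_ser_true : (e.ser true).andE2 J = e.andDel J := by simp [ser, andE2, andDel, PDat.a2_ser_true]
/-- `andE2` after a series edge in replica 2. [folklore] -/
theorem andE2_ser_false : (e.ser false).andE2 J = e.andE2 J := by simp [ser, andE2, PDat.a2_ser_false]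
/-- `andE1` after a parallel edge in replica 1. [folklore] -/
theorem andE1_par_true : (e.par true).andE1 J = e.andE1 (J - 1) := by simp [par, andE1, PDat.a1_par_true]
/-- `andE1` after a parallel edge in replica 2. [folklore] -/
theorem andE1_par_false : (e.par false).andE1 J = e.andCon J := by simp [par, andE1, andCon, PDat.a1_par_false]
/-- `andE2` after a parallel edge in replica 1. [folklore] -/
theorem andE2_par_true : (e.par true).andE2 J = e.andCon J := by simp [par, andE2, andCon, PDat.a2_par_true]
/-- `andE2` after a parallel edge in replica 2. [folklore] -/
theorem andE2_par_false : (e.par false).andE2 J = e.andE2 (J - 1) := by simp [par, andE2, PDat.a2_par_false]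

end EDat

section Steps

variable {C : Type*} [Fintype C] [Preorder C]

omit [Fintype C] in
/-- The diagonal `b ↦ (b, b, γ)` is monotone, so diagonal sections of monotone weights are monotone. [folklore] -/
theorem mono_diag {H : Bool × (Bool × C) → ℝ} (hH : Monotone H) : Monotone fun p : Bool × C => H (p.1, p.1, p.2) :=
  fun _ _ hxy => hH (Prod.mk_le_mk.2 ⟨(Prod.mk_le_mk.1 hxy).1, Prod.mk_le_mk.2 ⟨(Prod.mk_le_mk.1 hxy).1, (Prod.mk_le_mk.1 hxy).2⟩⟩)

/-- **(PQ) transfers nonnegativity**: `M̃_{g∥(g'∥𝓔)} ≥ 0` follows from `M̃_{g'∥𝓔} ≥ 0` (on the diagonal sections) and the contracted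
AND of `𝓔` (on the mixed sections). [folklore] -/
theorem Mt_par_par_nonneg {E : Env C}
    (hP : ∀ h0 h1 : Bool × C → ℝ, Monotone h0 → Monotone h1 → (∀ p, 0 ≤ h0 p) → (∀ p, h0 p ≤ h1 p) → ∀ J : ℤ,
      0 ≤ Mt (parE E) h0 h1 J)
    (hc : ∀ h : C → ℝ, Monotone h → (∀ γ, 0 ≤ h γ) → ∀ J : ℤ, 0 ≤ ∑ γ, h γ * (E γ).andCon J)
    {H0 H1 : Bool × (Bool × C) → ℝ} (m0 : Monotone H0) (m1 : Monotone H1) (n0 : ∀ p, 0 ≤ H0 p) (le : ∀ p, H0 p ≤ H1 p)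
    (J : ℤ) : 0 ≤ Mt (parE (parE E)) H0 H1 J := by
  have key : Mt (parE (parE E)) H0 H1 J =
      Mt (parE E) (fun p => H0 (p.1, p.1, p.2)) (fun p => H1 (p.1, p.1, p.2)) (J - 1)
      + ∑ γ, (H1 (true, false, γ) + H0 (true, false, γ)) * (E γ).andCon (J - 1)
      + ∑ γ, (H1 (false, true, γ) + H0 (false, true, γ)) * (E γ).andCon (J - 1)
      + ∑ γ, ((H1 (true, false, γ) - H0 (true, false, γ)) + (H1 (false, true, γ) - H0 (false, true, γ))) * (E γ).rconE J := by
    unfold Mt; rw [sum_bool_prod, sum_bool_prod, sum_bool_prod, sum_bool_prod]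
    have e1 : ∀ γ, (parE (parE E) (true, false, γ)) = ((E γ).par false).par (!false) := fun γ => rfl
    have e2 : ∀ γ, (parE (parE E) (false, true, γ)) = ((E γ).par true).par (!true) := fun γ => rfl
    simp only [e1, e2, EDat.slot1_par_par_mixed, EDat.slot0_par_par_mixed]
    simp only [parE, EDat.slot1_par_par_same, EDat.slot0_par_par_same]
    simp only [← Finset.sum_add_distrib]
    exact Finset.sum_congr rfl fun γ _ => by ring
  rw [key]
  have hd0 : Monotone fun p : Bool × C => H0 (p.1, p.1, p.2) := mono_diag m0
  have hd1 : Monotone fun p : Bool × C => H1 (p.1, p.1, p.2) := mono_diag m1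
  refine add_nonneg (add_nonneg (add_nonneg (hP _ _ hd0 hd1 (fun p => n0 _) (fun p => le _) _) ?_) ?_) ?_
  · exact hc _ ((mono_sec (mono_sec m1 true) false).add (mono_sec (mono_sec m0 true) false))
      (fun γ => add_nonneg ((n0 _).trans (le _)) (n0 _)) _
  · exact hc _ ((mono_sec (mono_sec m1 false) true).add (mono_sec (mono_sec m0 false) true))
      (fun γ => add_nonneg ((n0 _).trans (le _)) (n0 _)) _
  · exact Finset.sum_nonneg fun γ _ => mul_nonneg (add_nonneg (sub_nonneg.2 (le _)) (sub_nonneg.2 (le _))) ((E γ).rconE_nonneg J)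

/-- The deleted AND of `f·𝓔` from the deleted AND of `𝓔`. [folklore] -/
theorem andDel_ser_nonneg {E : Env C}
    (hd : ∀ h : C → ℝ, Monotone h → (∀ γ, 0 ≤ h γ) → ∀ J : ℤ, 0 ≤ ∑ γ, h γ * (E γ).andDel J)
    {H : Bool × C → ℝ} (m : Monotone H) (n : ∀ p, 0 ≤ H p) (J : ℤ) : 0 ≤ ∑ p, H p * (serE E p).andDel J := by
  rw [sum_bool_prod]; simp only [serE, EDat.andDel_ser]
  exact add_nonneg (hd _ (mono_sec m true) (fun γ => n _) J) (hd _ (mono_sec m false) (fun γ => n _) J)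

/-- The deleted AND of `g∥𝓔` from the free nested AND of `𝓔`. [folklore] -/
theorem andDel_par_nonneg {E : Env C}
    (hf : ∀ h0 h1 : C → ℝ, Monotone h0 → Monotone h1 → (∀ γ, 0 ≤ h0 γ) → (∀ γ, h0 γ ≤ h1 γ) → ∀ J : ℤ,
      0 ≤ ∑ γ, (h1 γ * (E γ).andE1 J + h0 γ * (E γ).andE2 J))
    {H : Bool × C → ℝ} (m : Monotone H) (n : ∀ p, 0 ≤ H p) (J : ℤ) : 0 ≤ ∑ p, H p * (parE E p).andDel J := by
  rw [sum_bool_prod]; simp only [parE, EDat.andDel_par_true, EDat.andDel_par_false]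
  rw [← Finset.sum_add_distrib]
  exact hf _ _ (mono_sec m false) (mono_sec m true) (fun γ => n _) (fun γ => sec_le m γ) J

/-- The contracted AND of `f·𝓔` from the free nested AND of `𝓔`. [folklore] -/
theorem andCon_ser_nonneg {E : Env C}
    (hf : ∀ h0 h1 : C → ℝ, Monotone h0 → Monotone h1 → (∀ γ, 0 ≤ h0 γ) → (∀ γ, h0 γ ≤ h1 γ) → ∀ J : ℤ,
      0 ≤ ∑ γ, (h1 γ * (E γ).andE1 J + h0 γ * (E γ).andE2 J))
    {H : Bool × C → ℝ} (m : Monotone H) (n : ∀ p, 0 ≤ H p) (J : ℤ) : 0 ≤ ∑ p, H p * (serE E p).andCon J := by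
  rw [sum_bool_prod]; simp only [serE, EDat.andCon_ser_true, EDat.andCon_ser_false]
  rw [← Finset.sum_add_distrib]
  exact hf _ _ (mono_sec m false) (mono_sec m true) (fun γ => n _) (fun γ => sec_le m γ) J

/-- The contracted AND of `g∥𝓔` from the contracted AND of `𝓔`. [folklore] -/
theorem andCon_par_nonneg {E : Env C}
    (hc : ∀ h : C → ℝ, Monotone h → (∀ γ, 0 ≤ h γ) → ∀ J : ℤ, 0 ≤ ∑ γ, h γ * (E γ).andCon J)
    {H : Bool × C → ℝ} (m : Monotone H) (n : ∀ p, 0 ≤ H p) (J : ℤ) : 0 ≤ ∑ p, H p * (parE E p).andCon J := by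
  rw [sum_bool_prod]; simp only [parE, EDat.andCon_par]
  exact add_nonneg (hc _ (mono_sec m true) (fun γ => n _) _) (hc _ (mono_sec m false) (fun γ => n _) _)

/-- The free nested AND of `f·𝓔` from the free nested AND and the deleted AND of `𝓔`. [folklore] -/
theorem andFree_ser_nonneg {E : Env C}
    (hf : ∀ h0 h1 : C → ℝ, Monotone h0 → Monotone h1 → (∀ γ, 0 ≤ h0 γ) → (∀ γ, h0 γ ≤ h1 γ) → ∀ J : ℤ,
      0 ≤ ∑ γ, (h1 γ * (E γ).andE1 J + h0 γ * (E γ).andE2 J))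
    (hd : ∀ h : C → ℝ, Monotone h → (∀ γ, 0 ≤ h γ) → ∀ J : ℤ, 0 ≤ ∑ γ, h γ * (E γ).andDel J)
    {H0 H1 : Bool × C → ℝ} (m0 : Monotone H0) (m1 : Monotone H1) (n0 : ∀ p, 0 ≤ H0 p) (le : ∀ p, H0 p ≤ H1 p) (J : ℤ) :
    0 ≤ ∑ p, (H1 p * (serE E p).andE1 J + H0 p * (serE E p).andE2 J) := by
  rw [sum_bool_prod]
  simp only [serE, EDat.andE1_ser_true, EDat.andE1_ser_false, EDat.andE2_ser_true, EDat.andE2_ser_false]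
  have : ∑ γ, (H1 (true, γ) * (E γ).andE1 J + H0 (true, γ) * (E γ).andDel J)
      + ∑ γ, (H1 (false, γ) * (E γ).andDel J + H0 (false, γ) * (E γ).andE2 J)
      = ∑ γ, (H1 (true, γ) * (E γ).andE1 J + H0 (false, γ) * (E γ).andE2 J)
        + ∑ γ, H0 (true, γ) * (E γ).andDel J + ∑ γ, H1 (false, γ) * (E γ).andDel J := by
    rw [← Finset.sum_add_distrib, ← Finset.sum_add_distrib, ← Finset.sum_add_distrib]
    exact Finset.sum_congr rfl fun γ _ => by ring
  rw [this]
  exact add_nonneg (add_nonneg (hf _ _ (mono_sec m0 false) (mono_sec m1 true) (fun γ => n0 _)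
    (fun γ => (sec_le m0 γ).trans (le _)) J) (hd _ (mono_sec m0 true) (fun γ => n0 _) J))
    (hd _ (mono_sec m1 false) (fun γ => (n0 _).trans (le _)) J)

/-- The free nested AND of `g∥𝓔` from the free nested AND and the contracted AND of `𝓔`. [folklore] -/
theorem andFree_par_nonneg {E : Env C}
    (hf : ∀ h0 h1 : C → ℝ, Monotone h0 → Monotone h1 → (∀ γ, 0 ≤ h0 γ) → (∀ γ, h0 γ ≤ h1 γ) → ∀ J : ℤ,
      0 ≤ ∑ γ, (h1 γ * (E γ).andE1 J + h0 γ * (E γ).andE2 J))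
    (hc : ∀ h : C → ℝ, Monotone h → (∀ γ, 0 ≤ h γ) → ∀ J : ℤ, 0 ≤ ∑ γ, h γ * (E γ).andCon J)
    {H0 H1 : Bool × C → ℝ} (m0 : Monotone H0) (m1 : Monotone H1) (n0 : ∀ p, 0 ≤ H0 p) (le : ∀ p, H0 p ≤ H1 p) (J : ℤ) :
    0 ≤ ∑ p, (H1 p * (parE E p).andE1 J + H0 p * (parE E p).andE2 J) := by
  rw [sum_bool_prod]
  simp only [parE, EDat.andE1_par_true, EDat.andE1_par_false, EDat.andE2_par_true, EDat.andE2_par_false]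
  have : ∑ γ, (H1 (true, γ) * (E γ).andE1 (J - 1) + H0 (true, γ) * (E γ).andCon J)
      + ∑ γ, (H1 (false, γ) * (E γ).andCon J + H0 (false, γ) * (E γ).andE2 (J - 1))
      = ∑ γ, (H1 (true, γ) * (E γ).andE1 (J - 1) + H0 (false, γ) * (E γ).andE2 (J - 1))
        + ∑ γ, (H0 (true, γ) + H1 (false, γ)) * (E γ).andCon J := by
    rw [← Finset.sum_add_distrib, ← Finset.sum_add_distrib]
    exact Finset.sum_congr rfl fun γ _ => by ring
  rw [this]
  exact add_nonneg (hf _ _ (mono_sec m0 false) (mono_sec m1 true) (fun γ => n0 _)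
    (fun γ => (sec_le m0 γ).trans (le _)) _)
    (hc _ ((mono_sec m0 true).add (mono_sec m1 false)) (fun γ => add_nonneg (n0 _) ((n0 _).trans (le _))) J)

end Steps



end RootForm

end FK

end Summit.CriticalPhenomena.PercolationContinuityZ3.Theorems
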